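import Mathlib
import Summits.Ventures.HodgeRepro.Tier4.Target
import Summits.Ventures.HodgeRepro.Tier4.Line3.Defs
import Summits.Ventures.HodgeRepro.Tier4.Line3.KMDatum
import Summits.Ventures.HodgeRepro.Tier4.Line3.KMDatumS
import Summits.Ventures.HodgeRepro.Tier4.Line3.CopyWeightGaussian
import Summits.Ventures.HodgeRepro.Tier4.Line3.CopyWeightBoundShrinkRed
import Summits.Ventures.HodgeRepro.Tier4.Line3.CopyCountRay
import Summits.Ventures.HodgeRepro.Tier4.Line3.HKRayReduction
import Summits.Ventures.HodgeRepro.Tier4.Line3.DatumOrthVanishing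
import Summits.Ventures.HodgeRepro.Tier4.Line3.Transvection
import Summits.Ventures.HodgeRepro.Tier4.Line3.KMKernelForm
import Summits.Ventures.HodgeRepro.Tier4.Line3.KMDilation
import Summits.Ventures.HodgeRepro.Tier4.Line3.ConeAnn

/-!
# Tier4/Line3/KMContinuity — the Kudla–Millson integrand is continuous on the ball

Blind re-derivation cell `pub-hodge-repro`, Tier 4 «PROVE THE STEP», LINE L3, seat t4-x2 (g4, reserve wall-breaker),
cut C-L3-HKRAY: the measurability input of the upper Laplace bound (`KMLaplaceUpper`, KMLaplace): `kmDatum`, `kmKernel`,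
`kmGaussFree`, `redMaj`, `kmDilInt` are continuous on the open ball (every denominator is `1 − |z|² ≠ 0` there), hence
`kmDilInt xm α β` is a.e.-strongly measurable on the ball — the clause every domination argument needs.

Nothing here says anything about the status of the Hodge conjecture for CM abelian varieties, which is NOT proved
(HC_CM is NOT proved by anyone in this repository).
-/

set_option autoImplicit false

noncomputable section

namespace Summit.Ventures.HodgeRepro.Tier4.Line3

open Summit.Ventures.HodgeRepro.Tier4
open Matrix MeasureTheory
open scoped ComplexConjugate

/-- `nsq` is continuous. -/
theorem continuous_nsq_km : Continuous nsq := by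
  unfold nsq
  fun_prop

/-- `z ↦ (lift3 z)^* J y` is continuous. -/
theorem continuous_jform_lift3_km (y : Fin 3 → ℂ) :
    Continuous (fun z : Fin 2 → ℂ => star (lift3 z) ⬝ᵥ (J *ᵥ y)) := by
  have : (fun z : Fin 2 → ℂ => star (lift3 z) ⬝ᵥ (J *ᵥ y)) = fun z => conj (z 0) * y 0 + conj (z 1) * y 1 - y 2 := by
    funext z
    rw [jform_eq]
    simp [lift3]
  rw [this]
  fun_prop

/-- `1 − nsq z ≠ 0` on the ball (as a complex number). -/
theorem one_sub_nsq_ne_zero_km {z : Fin 2 → ℂ} (hz : z ∈ ball) : ((1 - nsq z : ℝ) : ℂ) ≠ 0 := by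
  have h : nsq z < 1 := hz
  exact_mod_cast (by linarith : (1 - nsq z : ℝ) ≠ 0)

/-- `z ↦ ((1 − nsq z : ℝ) : ℂ)` is continuous. -/
theorem continuous_one_sub_nsq_km : Continuous (fun z : Fin 2 → ℂ => ((1 - nsq z : ℝ) : ℂ)) :=
  Complex.continuous_ofReal.comp (continuous_const.sub continuous_nsq_km)

/-- `maj y` is continuous on the ball. -/
theorem continuousOn_maj_km (y : Fin 3 → ℂ) : ContinuousOn (fun z => maj y z) ball := by
  unfold maj
  refine ContinuousOn.add continuousOn_const ?_
  refine ContinuousOn.div (ContinuousOn.mul continuousOn_const ?_) (continuous_const.sub continuous_nsq_km).continuousOn ?_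
  · exact ((continuous_jform_lift3_km y).norm.pow 2).continuousOn
  · intro z hz
    have h : nsq z < 1 := hz
    linarith

/-- The Gaussian of the majorant is continuous on the ball. -/
theorem continuousOn_expMaj_km (y : Fin 3 → ℂ) :
    ContinuousOn (fun z => ((Real.exp (-Real.pi * maj y z) : ℝ) : ℂ)) ball :=
  Complex.continuous_ofReal.comp_continuousOn (Real.continuous_exp.comp_continuousOn
    (continuousOn_const.mul (continuousOn_maj_km y)))

/-- `kmDatum y · l` is continuous on the ball. -/
theorem continuousOn_kmDatum (y : Fin 3 → ℂ) (l : Fin 2) : ContinuousOn (fun z => kmDatum y z l) ball := by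
  unfold kmDatum
  have hf := continuous_jform_lift3_km y
  have hg := continuous_one_sub_nsq_km
  have hne : ∀ z ∈ ball, ((1 - nsq z : ℝ) : ℂ) ≠ 0 := fun z hz => one_sub_nsq_ne_zero_km hz
  have hne2 : ∀ z ∈ ball, ((1 - nsq z : ℝ) : ℂ) ^ 2 ≠ 0 := fun z hz => pow_ne_zero 2 (one_sub_nsq_ne_zero_km hz)
  refine ContinuousOn.mul (ContinuousOn.neg (ContinuousOn.add ?_ ?_)) (continuousOn_expMaj_km y)
  · exact ContinuousOn.div (hf.mul continuous_const).continuousOn hg.continuousOn hne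
  · exact ContinuousOn.div (((Complex.continuous_conj.comp hf).mul hf).mul
      (Complex.continuous_conj.comp (continuous_apply l))).continuousOn (hg.pow 2).continuousOn hne2

namespace T4Data

variable (X : T4Data)

/-- `kmKernel xm` is continuous on the ball. -/
theorem continuousOn_kmKernel (xm : X.Tuple) : ContinuousOn (fun z => X.kmKernel xm z) ball := by
  unfold kmKernel wedge
  have h : ∀ j l, ContinuousOn (fun z => kmDatum (X.ballCoord (xm j)) z l) ball :=
    fun j l => continuousOn_kmDatum _ l
  refine ContinuousOn.mul (ContinuousOn.sub ((h 0 0).mul (h 1 1)) ((h 0 1).mul (h 1 0)))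
    (Complex.continuous_conj.comp_continuousOn (ContinuousOn.sub ((h 2 0).mul (h 3 1)) ((h 2 1).mul (h 3 0))))

/-- `redMaj xm j` is continuous on the ball. -/
theorem continuousOn_redMaj (xm : X.Tuple) (j : Fin 4) : ContinuousOn (fun z => X.redMaj xm j z) ball := by
  unfold redMaj
  exact (continuousOn_maj_km _).sub continuousOn_const

/-- `kmGaussFree xm` is continuous on the ball. -/
theorem continuousOn_kmGaussFree (xm : X.Tuple) : ContinuousOn (fun z => X.kmGaussFree xm z) ball := by
  unfold kmGaussFree
  refine ContinuousOn.mul (Complex.continuous_re.comp_continuousOn (X.continuousOn_kmKernel xm)) ?_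
  exact Real.continuous_exp.comp_continuousOn (continuousOn_const.mul
    ((continuousOn_maj_km _).add (continuousOn_maj_km _)))

/-- **`kmDilInt xm α β` is continuous on the ball.** -/
theorem continuousOn_kmDilInt (xm : X.Tuple) (α β : ℝ) : ContinuousOn (fun z => X.kmDilInt xm α β z) ball := by
  unfold kmDilInt
  refine ContinuousOn.mul (X.continuousOn_kmGaussFree xm) ?_
  exact Real.continuous_exp.comp_continuousOn (ContinuousOn.neg (continuousOn_const.mul
    ((continuousOn_const.mul (X.continuousOn_redMaj xm 0)).add (continuousOn_const.mul (X.continuousOn_redMaj xm 1)))))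

/-- `kmDilInt xm α β` is a.e.-strongly measurable on the ball. -/
theorem aestronglyMeasurable_kmDilInt (xm : X.Tuple) (α β : ℝ) :
    AEStronglyMeasurable (fun z => X.kmDilInt xm α β z) (volume.restrict ball) :=
  (X.continuousOn_kmDilInt xm α β).aestronglyMeasurable measurableSet_ball_nsq

end T4Data

end Summit.Ventures.HodgeRepro.Tier4.Line3

end
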